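import Mathlib

/-!
# Symmetrised Jensen step for frustrated Fröhlich–Spencer expansions (solo paper §13.9, Theorem R5)

In the Fröhlich–Spencer lower bound on the two-point function of the `D ≥ 3` Villain model
[FS82, (2.78)–(2.80)] the observable enters each renormalised charge ensemble as a product of
ratios `(1 + z cos(φ_ρ - θ_ρ)) / (1 + z cos φ_ρ)` with deterministic phases `θ_ρ` and random
`φ_ρ`; Jensen's inequality in the (positive, normalised) ensemble measure gives
`log R(θ) ≥ -Σ γ(z_ρ) θ_ρ² + Σ sin θ_ρ ⟨w(φ_ρ)⟩`, and FS82 discard the odd term because their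
measure is even in `φ`.  At non-integer boson filling (an imaginary background gauge field) the
measure is NOT even.  The replacement recorded here: the complex-conjugate observable has phases
`-θ_ρ`, the SAME even part and the OPPOSITE odd part, so averaging the two Jensen bounds and using
`cosh ≥ 1` removes the odd term with no estimate on it whatsoever.

* `exp_integral_log_le_integral` — Jensen for `exp`: `exp (∫ log f dμ) ≤ ∫ f dμ`;
* `exp_le_half_integral_add_integral` — the symmetrisation: if `∫ log f₊ ≥ S + T` and
  `∫ log f₋ ≥ S - T` then `(∫ f₊ + ∫ f₋)/2 ≥ exp S`;
* `log_villain_ratio_lower_bound` — the pointwise inequality behind FS82 (2.79) with explicit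
  constants: for `0 ≤ z ≤ 1/7` and all real `φ, θ`,
  `log((1 + z cos(φ-θ))/(1 + z cos φ)) ≥ -(z/(2(1-z)) + 2z²/(1-z)²) θ² + sin θ · (z sin φ/(1 + z cos φ))`,
  whose last term is odd in `θ`.
-/

namespace Summit.AtomisticToContinuum.BoseEinsteinCondensation.Theorems

open MeasureTheory

section SymmetrisedJensen

variable {Ω : Type*} [MeasurableSpace Ω] {μ : Measure Ω} [IsProbabilityMeasure μ]

/-- **Jensen for the exponential.** For a pointwise positive integrable `f` with integrable
`log f` on a probability space, `exp (∫ log f) ≤ ∫ f`. -/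
theorem exp_integral_log_le_integral {f : Ω → ℝ} (hf0 : ∀ ω, 0 < f ω)
    (hf : Integrable f μ) (hlf : Integrable (fun ω => Real.log (f ω)) μ) :
    Real.exp (∫ ω, Real.log (f ω) ∂μ) ≤ ∫ ω, f ω ∂μ := by
  have hcomp : (Real.exp ∘ fun ω => Real.log (f ω)) = f := by
    funext ω
    simp [Function.comp, Real.exp_log (hf0 ω)]
  have h := ConvexOn.map_integral_le (μ := μ) (f := fun ω => Real.log (f ω)) convexOn_exp
    Real.continuous_exp.continuousOn isClosed_univ (ae_of_all μ fun _ => Set.mem_univ _) hlf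
    (by rw [hcomp]; exact hf)
  refine h.trans_eq (integral_congr_ae (ae_of_all μ fun ω => ?_))
  simp [Real.exp_log (hf0 ω)]

/-- **Symmetrised Jensen.** If the Jensen exponents of two positive observables are bounded below
by `S + T` and `S - T` respectively (same even part `S`, opposite odd parts `±T`), then the average
of their expectations is at least `exp S` — the odd part `T` needs no estimate (`cosh T ≥ 1`). -/
theorem exp_le_half_integral_add_integral {f g : Ω → ℝ} (hf0 : ∀ ω, 0 < f ω) (hg0 : ∀ ω, 0 < g ω)
    (hf : Integrable f μ) (hg : Integrable g μ)
    (hlf : Integrable (fun ω => Real.log (f ω)) μ) (hlg : Integrable (fun ω => Real.log (g ω)) μ)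
    {S T : ℝ} (hSp : S + T ≤ ∫ ω, Real.log (f ω) ∂μ) (hSm : S - T ≤ ∫ ω, Real.log (g ω) ∂μ) :
    Real.exp S ≤ (∫ ω, f ω ∂μ + ∫ ω, g ω ∂μ) / 2 := by
  have h1 : Real.exp (S + T) ≤ ∫ ω, f ω ∂μ :=
    (Real.exp_le_exp.mpr hSp).trans (exp_integral_log_le_integral hf0 hf hlf)
  have h2 : Real.exp (S - T) ≤ ∫ ω, g ω ∂μ :=
    (Real.exp_le_exp.mpr hSm).trans (exp_integral_log_le_integral hg0 hg hlg)
  have hcosh : Real.exp (S + T) + Real.exp (S - T) = 2 * (Real.exp S * Real.cosh T) := by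
    rw [Real.cosh_eq, Real.exp_add, sub_eq_add_neg, Real.exp_add]
    ring
  have hc : Real.exp S * 1 ≤ Real.exp S * Real.cosh T :=
    mul_le_mul_of_nonneg_left (Real.one_le_cosh T) (Real.exp_pos S).le
  linarith

end SymmetrisedJensen

section VillainRatio

/-- The Villain-ratio denominator: `1 - z ≤ 1 + z cos φ` for `z ≥ 0`. -/
theorem one_sub_le_one_add_mul_cos {z : ℝ} (hz0 : 0 ≤ z) (φ : ℝ) :
    1 - z ≤ 1 + z * Real.cos φ := by
  nlinarith [Real.neg_one_le_cos φ]

/-- `log (1 + u) ≥ u - 2u²` for `u ≥ -1/2` (from `1 - x⁻¹ ≤ log x`). -/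
theorem sub_two_mul_sq_le_log_one_add {u : ℝ} (hu : -1 / 2 ≤ u) :
    u - 2 * u ^ 2 ≤ Real.log (1 + u) := by
  have hpos : 0 < 1 + u := by linarith
  have hne : 1 + u ≠ 0 := hpos.ne'
  have h1 : 1 - (1 + u)⁻¹ ≤ Real.log (1 + u) := Real.one_sub_inv_le_log_of_pos hpos
  have h2 : u - 2 * u ^ 2 ≤ 1 - (1 + u)⁻¹ := by
    rw [show (1 : ℝ) - (1 + u)⁻¹ = u / (1 + u) by field_simp; ring]
    rw [le_div_iff₀ hpos]
    nlinarith [mul_nonneg (sq_nonneg u) (by linarith : (0 : ℝ) ≤ 1 + 2 * u)]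
  exact h2.trans h1

/-- Cauchy–Schwarz + `1 - cos θ ≤ θ²/2`: the numerator of `E + O` is at most `|θ|`. -/
theorem sq_cos_mul_add_sin_mul_le (φ θ : ℝ) :
    (Real.cos φ * (Real.cos θ - 1) + Real.sin φ * Real.sin θ) ^ 2 ≤ θ ^ 2 := by
  have hcs : (Real.cos φ * (Real.cos θ - 1) + Real.sin φ * Real.sin θ) ^ 2
      + (Real.cos φ * Real.sin θ - Real.sin φ * (Real.cos θ - 1)) ^ 2
      = (Real.sin φ ^ 2 + Real.cos φ ^ 2) * ((Real.cos θ - 1) ^ 2 + Real.sin θ ^ 2) := by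
    ring
  have h1 : Real.sin φ ^ 2 + Real.cos φ ^ 2 = 1 := Real.sin_sq_add_cos_sq φ
  have h2 : (Real.cos θ - 1) ^ 2 + Real.sin θ ^ 2 = 2 - 2 * Real.cos θ := by
    nlinarith [Real.sin_sq_add_cos_sq θ]
  have h3 : 1 - θ ^ 2 / 2 ≤ Real.cos θ := Real.one_sub_sq_div_two_le_cos
  nlinarith [sq_nonneg (Real.cos φ * Real.sin θ - Real.sin φ * (Real.cos θ - 1))]

/-- The even numerator: `cos φ (cos θ - 1) ≥ cos θ - 1 ≥ -θ²/2`. -/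
theorem neg_sq_div_two_le_cos_mul (φ θ : ℝ) :
    -(θ ^ 2 / 2) ≤ Real.cos φ * (Real.cos θ - 1) := by
  have h3 : 1 - θ ^ 2 / 2 ≤ Real.cos θ := Real.one_sub_sq_div_two_le_cos
  nlinarith [mul_nonneg (sub_nonneg.2 (Real.cos_le_one φ)) (sub_nonneg.2 (Real.cos_le_one θ))]

/-- Crude size of the numerator: `≥ -3`. -/
theorem neg_three_le_cos_mul_add_sin_mul (φ θ : ℝ) :
    -3 ≤ Real.cos φ * (Real.cos θ - 1) + Real.sin φ * Real.sin θ := by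
  nlinarith [mul_nonneg (sub_nonneg.2 (Real.cos_le_one φ)) (sub_nonneg.2 (Real.cos_le_one θ)),
    Real.neg_one_le_cos θ, sq_nonneg (Real.sin φ + Real.sin θ), Real.sin_sq_add_cos_sq φ,
    Real.sin_sq_add_cos_sq θ, sq_nonneg (Real.cos φ), sq_nonneg (Real.cos θ)]

/-- **The pointwise inequality behind FS82 (2.79), with explicit constants.** For
`0 ≤ z ≤ 1/7` and all real `φ, θ`:
`log((1 + z cos(φ - θ))/(1 + z cos φ)) ≥ -(z/(2(1-z)) + 2 z²/(1-z)²) θ² + sin θ · (z sin φ/(1 + z cos φ))`.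
The last term is odd in `θ`; its expectation in a non-even ensemble is what the symmetrisation
`exp_le_half_integral_add_integral` disposes of. -/
theorem log_villain_ratio_lower_bound {z : ℝ} (hz0 : 0 ≤ z) (hz : z ≤ 1 / 7) (φ θ : ℝ) :
    -(z / (2 * (1 - z)) + 2 * z ^ 2 / (1 - z) ^ 2) * θ ^ 2
        + Real.sin θ * (z * Real.sin φ / (1 + z * Real.cos φ))
      ≤ Real.log ((1 + z * Real.cos (φ - θ)) / (1 + z * Real.cos φ)) := by
  -- notation: D = denominator, Nm = numerator of E + O, u = E + O
  obtain ⟨D, hD⟩ : ∃ D, D = 1 + z * Real.cos φ := ⟨_, rfl⟩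
  obtain ⟨Nm, hNm⟩ : ∃ Nm, Nm = Real.cos φ * (Real.cos θ - 1) + Real.sin φ * Real.sin θ := ⟨_, rfl⟩
  have h1z : 0 < 1 - z := by linarith
  have hD1 : 1 - z ≤ D := hD ▸ one_sub_le_one_add_mul_cos hz0 φ
  have hDpos : 0 < D := lt_of_lt_of_le h1z hD1
  have hDne : D ≠ 0 := hDpos.ne'
  rw [← hD]
  -- the ratio is 1 + u with u = z Nm / D
  have hnum : 1 + z * Real.cos (φ - θ) = D + z * Nm := by
    rw [hD, hNm, Real.cos_sub]
    ring
  have hratio : (1 + z * Real.cos (φ - θ)) / D = 1 + z * Nm / D := by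
    rw [hnum, add_div, div_self hDne]
  rw [hratio]
  -- u ≥ -1/2
  have hNm3 : -3 ≤ Nm := hNm ▸ neg_three_le_cos_mul_add_sin_mul φ θ
  have hu : -1 / 2 ≤ z * Nm / D := by
    rw [le_div_iff₀ hDpos]
    nlinarith [mul_le_mul_of_nonneg_left hNm3 hz0]
  have hlog := sub_two_mul_sq_le_log_one_add hu
  -- even part: z cos φ (cos θ - 1) / D ≥ -(z θ²/2)/(1 - z)
  have hE1 : z * (-(θ ^ 2 / 2)) ≤ z * (Real.cos φ * (Real.cos θ - 1)) :=
    mul_le_mul_of_nonneg_left (neg_sq_div_two_le_cos_mul φ θ) hz0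
  have hE2 : z * (-(θ ^ 2 / 2)) / D ≤ z * (Real.cos φ * (Real.cos θ - 1)) / D :=
    div_le_div_of_nonneg_right hE1 hDpos.le
  have hE3 : z * (θ ^ 2 / 2) / D ≤ z * (θ ^ 2 / 2) / (1 - z) :=
    div_le_div_of_nonneg_left (by positivity) h1z hD1
  -- odd/even decomposition of u
  have hsplit : z * Nm / D
      = z * (Real.cos φ * (Real.cos θ - 1)) / D + Real.sin θ * (z * Real.sin φ / D) := by
    rw [hNm]
    ring
  -- u² ≤ z² θ² / (1 - z)²
  have hN2 : Nm ^ 2 ≤ θ ^ 2 := hNm ▸ sq_cos_mul_add_sin_mul_le φ θ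
  have hu2a : (z * Nm / D) ^ 2 = z ^ 2 * Nm ^ 2 / D ^ 2 := by ring
  have hu2b : z ^ 2 * Nm ^ 2 / D ^ 2 ≤ z ^ 2 * θ ^ 2 / D ^ 2 :=
    div_le_div_of_nonneg_right (mul_le_mul_of_nonneg_left hN2 (sq_nonneg z)) (by positivity)
  have hu2c : z ^ 2 * θ ^ 2 / D ^ 2 ≤ z ^ 2 * θ ^ 2 / (1 - z) ^ 2 :=
    div_le_div_of_nonneg_left (by positivity) (by positivity) (by nlinarith [hD1, h1z])
  -- bookkeeping of the constant
  have hconst : -(z / (2 * (1 - z)) + 2 * z ^ 2 / (1 - z) ^ 2) * θ ^ 2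
      = -(z * (θ ^ 2 / 2) / (1 - z)) - 2 * (z ^ 2 * θ ^ 2 / (1 - z) ^ 2) := by
    field_simp
    ring
  have hneg : z * (-(θ ^ 2 / 2)) / D = -(z * (θ ^ 2 / 2) / D) := by ring
  rw [hconst]
  calc -(z * (θ ^ 2 / 2) / (1 - z)) - 2 * (z ^ 2 * θ ^ 2 / (1 - z) ^ 2)
        + Real.sin θ * (z * Real.sin φ / D)
      ≤ (z * (Real.cos φ * (Real.cos θ - 1)) / D + Real.sin θ * (z * Real.sin φ / D))
          - 2 * (z * Nm / D) ^ 2 := by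
        rw [hu2a]
        linarith [hE2, hE3, hu2b, hu2c, hneg]
    _ = z * Nm / D - 2 * (z * Nm / D) ^ 2 := by rw [← hsplit]
    _ ≤ Real.log (1 + z * Nm / D) := hlog

end VillainRatio

end Summit.AtomisticToContinuum.BoseEinsteinCondensation.Theorems
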